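import Summits.BirchSwinnertonDyer.BirchSwinnertonDyer.Theorems.EisensteinPrimesBSDpOnCellCResidualPub
import HarnessLib

/-!
# [telescope v21 — LEAD cruxlead-19034 g9, 2026-08-30; CAS-lane] THE VALUE ROAD AT EVERY `p` FROM LZZ18 — one-regime twin of the Reoriented composition + the ResidualPub head, WITHOUT the Castella 2018 Thms. 2.10–2.11 conjunct (`--supports`, helper)

Crux 4 `BSDpOnCellC` (stmt-BirchSwinnertonDyer-19034), line «telescope» v21. The LEAD g9 leaf census (`Cruxes/BSDpOnCellC/INPUT-LEAF-CENSUS-g9.md`) found the cited input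
`Castella2018Exceptional.thm210_thm211_bdpDisplay_pNew` (conjunct 14 of `stub_publishedFacts`, typed for `5 ≤ p`) consumed at ONE leaf, `X2.continuousDisplay_pNew_of_bdpDisplay`, which feeds only
the `5 ≤ p` branch of `Reoriented.bsdpOnCellC_of_stubs_reoriented`; the `p = 3` branch (the `…intResidualsOther` theorems, general in `p` as typed) takes its value atoms from the LZZ road,
and that road is `p`-FREE as landed: `X2.lzzRoadInputIoo_of_thm151_thm153` ∘ `X2.bdpValueContinuousDisplayAt_of_lzzRoadInputIoo (W) (p)` ∘ `X2.{nonsplit,split}BDPValueOnTreeInt_of_signFree`.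
WHAT: `stub_c2_allP_of_thm151_thm153` (both value atoms at EVERY CellC pair from the LZZ fact `LiuZhangZhang2018.thm151_thm153_modularCurve_heegnerVector`);
`bsdpOnCellC_of_stubs_reoriented_allP` = `Reoriented.bsdpOnCellC_of_stubs_reoriented` with `hPub` = the 15 b1 conjuncts WITHOUT `thm210_thm211_bdpDisplay_pNew`, `h2` = the value atoms at every `p`
(no `p = 3 →`), and ONE regime in the proof (both signs go through `bsdp_of_cellC_of_{split,not_split}_of_manin_of_intResidualsOther`; the `5 ≤ p ∨ p = 3` split and the
`…pNewValue_of_imcIntOther` calls are gone; everything else token-identical); `bsdpOnCellC_of_publishedFacts_of_divIntOther_of_oneInequality_of_cellB_allP` = the ResidualPub §2 head with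
`hPub : (15 conjuncts) ∧ LZZ` (projection `hPub.1.1 ↦ hPub.1`) calling the two theorems above.
HOST WATCH h-W-CAS-1 (print side, not a kernel matter): the typed LZZ fact carries no `5 ≤ p` binder (`p ∣ N`, `¬ p² ∣ N`, `p` split in `K`);
whether LZZ Duke 167 Thms. 1.5.1/1.5.3 need a bound on `p` beyond Assumption 1.8.1 is a referee page-check booked by the host BEFORE any count moves.
HONEST FRAMING: theorems only (no definition, no named fact, no instance, no `sorry`); every theorem here is a TWIN of a landed tree theorem with
ONE hypothesis conjunct fewer (proof token-identical up to the projections/branches named below); CONDITIONAL on its remaining hypotheses;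
closes no registered stub, no crux, no summit statement; moves no count by itself (the by-name register is re-booked, if at all, by the host on the
landed closure `…OfCitedFactsR5` and a telescope re-cut is a LEAD act under a NEW director word); BSD is proved for no curve by this file.
References (shape only): [cite: Castella2018Exceptional, Thm. 2.10 and Thm. 2.11 (arXiv:1507.04260 pp. 13–14)] [cite: LiuZhangZhang2018, Thm. 1.5.1 and Thm. 1.5.3 (Duke Math. J. 167 pp. 745–749)]
-/

set_option autoImplicit false
set_option linter.dupNamespace false

noncomputable section

open scoped Classical MatrixGroups ModularForm

open CongruenceSubgroup WeierstrassCurve NumberField IsDedekindDomain Field PowerSeries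
  Literature.NumberTheory.EllipticCurves Literature.NumberTheory.EllipticCurves.GreenbergSelmer
  Literature.NumberTheory.EllipticCurves.ModularForms Literature.NumberTheory.QuadraticFields
  Literature.NumberTheory.EllipticCurves.Rank1Residual
  Literature.NumberTheory.EllipticCurves.Rank1Residual.Typed
  Literature.NumberTheory.EllipticCurves.KrizLi2019
  Literature.NumberTheory.EllipticCurves.GreenbergVatsal2000
  Literature.NumberTheory.EllipticCurves.Wuthrich2014
  Literature.NumberTheory.EllipticCurves.SteinWuthrich2013
  Literature.NumberTheory.EllipticCurves.Castella2018Exceptional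
  Literature.NumberTheory.GaloisRepresentations Literature.NumberTheory.GaloisCohomology
  Literature.NumberTheory.Automorphic
  Summit.BirchSwinnertonDyer.Rank1Residual.X11b.AcSelmer
  Summit.BirchSwinnertonDyer.Rank1Residual.X11b.Halves
  Summit.BirchSwinnertonDyer.Rank1Residual.X11b
  Summit.BirchSwinnertonDyer.Rank1Residual.X2
  Summit.BirchSwinnertonDyer.Rank1Residual
open Summit.BirchSwinnertonDyer.BirchSwinnertonDyer.Theorems.StubC3OneInequality

namespace Summit.BirchSwinnertonDyer.BirchSwinnertonDyer.Theorems.ReorientedLZZAllP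

open Summit.BirchSwinnertonDyer.BirchSwinnertonDyer.Theorems.Reoriented

/-- **`stub_c2` at EVERY `p` from the refereed LZZ fact** (no `p = 3` restriction): the sign-free continuous display
`X2.BDPValueContinuousDisplayAt W p` holds at every `W, p` from `LiuZhangZhang2018.thm151_thm153_modularCurve_heegnerVector`
(`X2.bdpValueContinuousDisplayAt_of_lzzRoadInputIoo ∘ X2.lzzRoadInputIoo_of_thm151_thm153`, tree theorems, `p`-free), hence both
value atoms (`X2.nonsplitBDPValueOnTreeInt_of_signFree`, `X2.splitBDPValueOnTreeInt_of_signFree`). CONDITIONAL on the LZZ fact.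
[cite: LiuZhangZhang2018, Thm. 1.5.1 and Thm. 1.5.3 (Duke 167 pp. 748–749) (shape only)] -/
theorem stub_c2_allP_of_thm151_thm153 (hF : LiuZhangZhang2018.thm151_thm153_modularCurve_heegnerVector) :
    (∀ (W : WeierstrassCurve ℚ) [W.IsElliptic] [W.IsGloballyMinimal] (p : ℕ) [Fact p.Prime],
        CellC W p → ¬ W.HasSplitMultiplicativeReductionAtPrime p → NonsplitBDPValueOnTreeInt W p) ∧
      (∀ (W : WeierstrassCurve ℚ) [W.IsElliptic] [W.IsGloballyMinimal] (p : ℕ) [Fact p.Prime],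
        CellC W p → W.HasSplitMultiplicativeReductionAtPrime p → SplitBDPValueOnTreeInt W p) :=
  ⟨fun W _ _ p _ _ _ ↦ X2.nonsplitBDPValueOnTreeInt_of_signFree
      (X2.bdpValueContinuousDisplayAt_of_lzzRoadInputIoo (X2.lzzRoadInputIoo_of_thm151_thm153 hF) W p),
    fun W _ _ p _ _ _ ↦ X2.splitBDPValueOnTreeInt_of_signFree
      (X2.bdpValueContinuousDisplayAt_of_lzzRoadInputIoo (X2.lzzRoadInputIoo_of_thm151_thm153 hF) W p)⟩

/-- **Twin of `Reoriented.bsdpOnCellC_of_stubs_reoriented` WITHOUT the [cas-split] conjunct, value atoms at EVERY `p`, ONE regime** (the `…intResidualsOther` road at every odd `p`; no `5 ≤ p` / `p = 3` split, no Castella 2.10/2.11). Hypotheses otherwise VERBATIM; proof token-identical minus the regime split. CONDITIONAL on every binder; nothing booked. [cite: LiuZhangZhang2018, Thm. 1.5.1 and Thm. 1.5.3 (shape only)] [claim: KellerYin2024, status: under-review] -/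
theorem bsdpOnCellC_of_stubs_reoriented_allP
    (hPub : lambdaMu_multiplicative_of_gvPar ∧ thm16_charIdeal_dvd_multiplicative_of_reducible ∧
      thm61_splitMultiplicative ∧ thm61_nonsplitMultiplicative ∧
      (∀ (W : WeierstrassCurve ℚ) [W.IsElliptic] [W.IsGloballyMinimal] (p : ℕ) [Fact p.Prime],
        greenberg_stevens (W := W) (p := p)) ∧
      exists_isNewformOf ∧
      (∀ (K : Type) [Field K] [NumberField K], poitouTate_selmerStructure_duality K) ∧
      (∀ (K : Type) [Field K] [NumberField K], poitouTate_sha_tateDual K) ∧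
      hsieh2014_exists_anticyclotomicPAdicLFunction ∧
      (∀ (N : ℕ) [NeZero N] (W : WeierstrassCurve ℚ) (K : Type) [Field K] [NumberField K],
        gross_zagier N W K) ∧
      (∀ (N : ℕ) [NeZero N] (W : WeierstrassCurve ℚ) (K : Type) [Field K] [NumberField K],
        kolyvagin N W K) ∧
      rank_eq_analyticRank_of_analyticRank_le_one ∧ HoffsteinLuo1997_exists_twist_L_one_ne_zero ∧
      mazur_not_dvd_maninConstant_of_odd ∧ bsdRHS_eq_of_isIsogenous)
    (h2 : (∀ (W : WeierstrassCurve ℚ) [W.IsElliptic] [W.IsGloballyMinimal] (p : ℕ) [Fact p.Prime],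
        CellC W p → ¬ W.HasSplitMultiplicativeReductionAtPrime p → NonsplitBDPValueOnTreeInt W p) ∧
      (∀ (W : WeierstrassCurve ℚ) [W.IsElliptic] [W.IsGloballyMinimal] (p : ℕ) [Fact p.Prime],
        CellC W p → W.HasSplitMultiplicativeReductionAtPrime p → SplitBDPValueOnTreeInt W p))
    (h3 : (∀ (W : WeierstrassCurve ℚ) [W.IsElliptic] [W.IsGloballyMinimal] (p : ℕ) [Fact p.Prime],
        CellC W p → ¬ W.HasSplitMultiplicativeReductionAtPrime p → NonsplitIMCEqOnTreeIntOther W p) ∧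
      (∀ (W : WeierstrassCurve ℚ) [W.IsElliptic] [W.IsGloballyMinimal] (p : ℕ) [Fact p.Prime],
        CellC W p → W.HasSplitMultiplicativeReductionAtPrime p → SplitIMCEqOnTreeIntOther W p))
    (hMCB : Summit.BirchSwinnertonDyer.BirchSwinnertonDyer.Theses.EisensteinPrimes.MazurMCOnCellB) :
    Summit.BirchSwinnertonDyer.BirchSwinnertonDyer.Theses.EisensteinPrimes.BSDpOnCellC := by
  obtain ⟨hGV, hWu, hJs, hJn, hGS, hnf, hPT, hPT2, hH, hGZ, hKo, hGZK, hHL, hMaz, hCassels⟩ := hPub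
  obtain ⟨h2n, h2s⟩ := h2
  obtain ⟨h3n, h3s⟩ := h3
  -- the eight PROVED published inputs, by name
  have hHs : exists_isSplitMultCanonical := SteinWuthrich2013.exists_isSplitMultCanonical_holds
  have hHn : exists_isMultCanonical := SteinWuthrich2013.exists_isMultCanonical_holds
  have hpar : nonempty_modularParametrizationData :=
    nonempty_modularParametrizationData_iff_exists_isNewformOf_unconditional.mpr hnf
  have hEP : ∀ (K : Type) [Field K] [NumberField K] (v : HeightOneSpectrum (𝓞 K)),
      localEulerPoincareCharacteristic (v.adicCompletion K) :=
    fun K _ _ v ↦ X11b.LocBridge.localEulerPoincareCharacteristic_adicCompletionEP K v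
  have hcd : fieldCdLE_two_of_numberField :=
    Literature.NumberTheory.GaloisRepresentations.fieldCdLE_two_of_numberField_holds
  have hBr : ∀ (K : Type) [Field K] [NumberField K] (p : ℕ) [Fact p.Prime],
      ZpExtension.decomp_not_le_kerSubgroup_of_isAnticyclotomic K p :=
    fun K _ _ p _ ↦ ZpExtension.decomp_not_le_kerSubgroup_of_isAnticyclotomic_holds (K := K) (p := p)
  have hHP : ∀ (N : ℕ) [NeZero N] (W : WeierstrassCurve ℚ) (K : Type) [Field K] [NumberField K],
      heegnerPointComplex_mem_range_map N W K :=
    fun N _ W K _ _ ↦ heegnerPointComplex_mem_range_map_holds N W K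
  have hEd : edixhoven_optimalManinConstant_integral :=
    ModularForms.edixhoven_optimalManinConstant_integral_holds
  unfold Summit.BirchSwinnertonDyer.BirchSwinnertonDyer.Theses.EisensteinPrimes.MazurMCOnCellB at hMCB
  unfold Summit.BirchSwinnertonDyer.BirchSwinnertonDyer.Theses.EisensteinPrimes.BSDpOnCellC
  intro W _ _ p _ hc
  -- the Manin condition moved to the optimal curve, then sign (ONE regime: the LZZ road at every `p`)
  refine bsdp_of_cellC_of_forall_isIsogenous hEd hMaz hCassels hpar hnf hGZK W p hc ?_
  intro W₀ _ _ hiso hc₀ hMan₀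
  by_cases hs : W.HasSplitMultiplicativeReductionAtPrime p
  · have hs₀ : W₀.HasSplitMultiplicativeReductionAtPrime p :=
      IsogenyQuotientLine.hasSplitMultiplicativeReductionAtPrime_of_isIsogenous hiso hs
    exact bsdp_of_cellC_of_split_of_manin_of_intResidualsOther W₀ p hGV hWu hJs hJn hHs hHn hpar hGS
      hnf hPT hPT2 hEP hBr hH hGZ hKo hHP hGZK hHL hc₀ hs₀ hMan₀ (h2s W₀ p hc₀ hs₀)
      (h3s W₀ p hc₀ hs₀) (fun W' _ _ hB _ ↦ hMCB W' p hB)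
  · have hns₀ : ¬ W₀.HasSplitMultiplicativeReductionAtPrime p := fun h ↦
      hs (IsogenyQuotientLine.hasSplitMultiplicativeReductionAtPrime_of_isIsogenous
        hiso.symm_of_charZero h)
    exact bsdp_of_cellC_of_not_split_of_manin_of_intResidualsOther W₀ p hGV hWu hJs hJn hHs hHn hpar
      hGS hnf hPT hPT2 hEP hcd hBr hH hGZ hKo hHP hGZK hHL hc₀ hns₀ hMan₀ (h2n W₀ p hc₀ hns₀)
      (h3n W₀ p hc₀ hns₀) (fun W' _ _ hB _ ↦ hMCB W' p hB)

/-- **Twin of `BSDpOnCellCResidualPub.bsdpOnCellC_of_publishedFacts_of_divIntOther_of_oneInequality_of_cellB` WITHOUT the [cas-split] conjunct** (`hPub : (15 b1 conjuncts) ∧ LZZ`; the value atoms at every `p` from `stub_c2_allP_of_thm151_thm153`; `stub_c3` from `BSDpOnCellCResidualPub.stub_c3_of_pub_of_divIntOther_of_oneInequality` as there). CONDITIONAL; nothing booked. [cite: LiuZhangZhang2018, Thm. 1.5.1 and Thm. 1.5.3 (shape only)] -/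
theorem bsdpOnCellC_of_publishedFacts_of_divIntOther_of_oneInequality_of_cellB_allP
    (hPub : (lambdaMu_multiplicative_of_gvPar ∧ thm16_charIdeal_dvd_multiplicative_of_reducible ∧
      thm61_splitMultiplicative ∧ thm61_nonsplitMultiplicative ∧
      (∀ (W : WeierstrassCurve ℚ) [W.IsElliptic] [W.IsGloballyMinimal] (p : ℕ) [Fact p.Prime],
        greenberg_stevens (W := W) (p := p)) ∧
      exists_isNewformOf ∧
      (∀ (K : Type) [Field K] [NumberField K], poitouTate_selmerStructure_duality K) ∧
      (∀ (K : Type) [Field K] [NumberField K], poitouTate_sha_tateDual K) ∧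
      hsieh2014_exists_anticyclotomicPAdicLFunction ∧
      (∀ (N : ℕ) [NeZero N] (W : WeierstrassCurve ℚ) (K : Type) [Field K] [NumberField K],
        gross_zagier N W K) ∧
      (∀ (N : ℕ) [NeZero N] (W : WeierstrassCurve ℚ) (K : Type) [Field K] [NumberField K],
        kolyvagin N W K) ∧
      rank_eq_analyticRank_of_analyticRank_le_one ∧ HoffsteinLuo1997_exists_twist_L_one_ne_zero ∧
      mazur_not_dvd_maninConstant_of_odd ∧ bsdRHS_eq_of_isIsogenous) ∧
      LiuZhangZhang2018.thm151_thm153_modularCurve_heegnerVector)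
    (hdivN : ∀ (W : WeierstrassCurve ℚ) [W.IsElliptic] [W.IsGloballyMinimal] (p : ℕ) [Fact p.Prime],
      CellC W p → ¬ W.HasSplitMultiplicativeReductionAtPrime p → NonsplitKolyvaginDivOnTreeIntOther W p)
    (hdivS : ∀ (W : WeierstrassCurve ℚ) [W.IsElliptic] [W.IsGloballyMinimal] (p : ℕ) [Fact p.Prime],
      CellC W p → W.HasSplitMultiplicativeReductionAtPrime p → SplitKolyvaginDivOnTreeIntOther W p)
    (hinvN : ∀ (W : WeierstrassCurve ℚ) [W.IsElliptic] [W.IsGloballyMinimal] (p : ℕ) [Fact p.Prime],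
      ∀ (N : ℕ) [NeZero N] (K : Type) [Field K] [NumberField K] (Dt : ModularParametrizationData W N)
        (H : HeegnerDatum N (NumberField.discr K)) (ιK : K →+* ℂ) (P : (W.baseChange K).toAffine.Point),
        CellC W p → ¬ W.HasSplitMultiplicativeReductionAtPrime p → W.conductorNorm ℤ = N →
        IsImaginaryQuadratic K → NumberField.discr K < -4 → SatisfiesHeegnerHypothesis N K →
        (W.quadraticTwist (NumberField.discr K : ℚ)).entireLFunction 1 ≠ 0 →
        WeierstrassCurve.Affine.Point.map ιK.toRatAlgHom P = heegnerPointComplex Dt H →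
        ¬ (p : ℤ) ∣ Dt.c → ¬ IsOfFinAddOrder P →
        Odd (NumberField.discr K) →
        ∀ (κ : ZpExtension K p), κ.IsAnticyclotomic →
          ∀ (γ : Field.absoluteGaloisGroup K) [Fact (κ.IsTopGenerator γ)]
            (𝔭 : HeightOneSpectrum (𝓞 K)), ((p : ℕ) : 𝓞 K) ∈ 𝔭.asIdeal →
            𝔭.asIdeal.ramificationIdx (𝓞 ℚ) = 1 → 𝔭.asIdeal.inertiaDeg (𝓞 ℚ) = 1 →
            ∀ (𝔭bar : HeightOneSpectrum (𝓞 K)), ((p : ℕ) : 𝓞 K) ∈ 𝔭bar.asIdeal → 𝔭bar ≠ 𝔭 →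
              ((Ideal.span {(p : ℤ)}).primesOver (𝓞 K)).ncard = 2 →
            ∀ (f : CuspForm (CongruenceSubgroup.Gamma0 N) 2), IsNewformOf W f →
              ∀ (ι' : PadicAlgCl p ≃+* ℂ),
                (∀ (w : InfinitePlace K) (k : 𝓞 K),
                  k ∈ 𝔭.asIdeal ↔ ‖ι'.symm (w.embedding (k : K))‖ < 1) →
                ∀ (ΩK : ℂ) (Ωp : ℂ_[p]) (Q : PowerSeries 𝓞_ℂ_[p]), ΩK ≠ 0 → ‖Ωp‖ = 1 →
                  R1.IsBDPLFunctionInt p ι' 𝔭 κ γ f ΩK Ωp Q →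
                    muInvariant p (XAc (W.baseChange K) p κ 𝔭bar ∅ γ) = 0 ∧
                    ∃ m ≤ lambdaInvariant p (XAc (W.baseChange K) p κ 𝔭bar ∅ γ),
                      ‖((PowerSeries.coeff m Q : 𝓞_ℂ_[p]) : ℂ_[p])‖ = 1 ∧
                        ∀ i < m, ‖((PowerSeries.coeff i Q : 𝓞_ℂ_[p]) : ℂ_[p])‖ < 1)
    (hinvS : ∀ (W : WeierstrassCurve ℚ) [W.IsElliptic] [W.IsGloballyMinimal] (p : ℕ) [Fact p.Prime],
      ∀ (N : ℕ) [NeZero N] (K : Type) [Field K] [NumberField K] (Dt : ModularParametrizationData W N)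
        (H : HeegnerDatum N (NumberField.discr K)) (ιK : K →+* ℂ) (P : (W.baseChange K).toAffine.Point),
        CellC W p → W.HasSplitMultiplicativeReductionAtPrime p → W.conductorNorm ℤ = N →
        IsImaginaryQuadratic K → NumberField.discr K < -4 → SatisfiesHeegnerHypothesis N K →
        (W.quadraticTwist (NumberField.discr K : ℚ)).entireLFunction 1 ≠ 0 →
        WeierstrassCurve.Affine.Point.map ιK.toRatAlgHom P = heegnerPointComplex Dt H →
        ¬ (p : ℤ) ∣ Dt.c → ¬ IsOfFinAddOrder P →
        Odd (NumberField.discr K) →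
        ∀ (κ : ZpExtension K p), κ.IsAnticyclotomic →
          ∀ (γ : Field.absoluteGaloisGroup K) [Fact (κ.IsTopGenerator γ)]
            (𝔭 : HeightOneSpectrum (𝓞 K)), ((p : ℕ) : 𝓞 K) ∈ 𝔭.asIdeal →
            𝔭.asIdeal.ramificationIdx (𝓞 ℚ) = 1 → 𝔭.asIdeal.inertiaDeg (𝓞 ℚ) = 1 →
            ∀ (𝔭bar : HeightOneSpectrum (𝓞 K)), ((p : ℕ) : 𝓞 K) ∈ 𝔭bar.asIdeal → 𝔭bar ≠ 𝔭 →
              ((Ideal.span {(p : ℤ)}).primesOver (𝓞 K)).ncard = 2 →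
            ∀ (f : CuspForm (CongruenceSubgroup.Gamma0 N) 2), IsNewformOf W f →
              ∀ (ι' : PadicAlgCl p ≃+* ℂ),
                (∀ (w : InfinitePlace K) (k : 𝓞 K),
                  k ∈ 𝔭.asIdeal ↔ ‖ι'.symm (w.embedding (k : K))‖ < 1) →
                ∀ (ΩK : ℂ) (Ωp : ℂ_[p]) (Q : PowerSeries 𝓞_ℂ_[p]), ΩK ≠ 0 → ‖Ωp‖ = 1 →
                  R1.IsBDPLFunctionInt p ι' 𝔭 κ γ f ΩK Ωp Q →
                    muInvariant p (XAc (W.baseChange K) p κ 𝔭bar ∅ γ) = 0 ∧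
                    ∃ m ≤ lambdaInvariant p (XAc (W.baseChange K) p κ 𝔭bar ∅ γ),
                      ‖((PowerSeries.coeff m Q : 𝓞_ℂ_[p]) : ℂ_[p])‖ = 1 ∧
                        ∀ i < m, ‖((PowerSeries.coeff i Q : 𝓞_ℂ_[p]) : ℂ_[p])‖ < 1)
    (hMCB : Summit.BirchSwinnertonDyer.BirchSwinnertonDyer.Theses.EisensteinPrimes.MazurMCOnCellB) :
    Summit.BirchSwinnertonDyer.BirchSwinnertonDyer.Theses.EisensteinPrimes.BSDpOnCellC := by
  obtain ⟨-, -, -, -, -, hnf, hPT, hPT2, -, -, -, hGZK, -, -, -⟩ := hPub.1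
  exact bsdpOnCellC_of_stubs_reoriented_allP hPub.1 (stub_c2_allP_of_thm151_thm153 hPub.2)
    (BSDpOnCellCResidualPub.stub_c3_of_pub_of_divIntOther_of_oneInequality hGZK hnf hPT hPT2 hdivN hdivS hinvN hinvS) hMCB

end Summit.BirchSwinnertonDyer.BirchSwinnertonDyer.Theorems.ReorientedLZZAllP

end
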